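import Summits.KontsevichZagierPeriods.KontsevichZagierPeriods.Theorems.UnfoldedStokesLegendreAllModuli
import Summits.KontsevichZagierPeriods.KontsevichZagierPeriods.Theorems.BetaCancellation.Negative.EulerReflectionStub
import Summits.KontsevichZagierPeriods.KontsevichZagierPeriods.Theses.CyclesAsDomains

/-!
# Line `legendre_signatures` — G1 next RUNG over the proved floor `LegendreAllModuli`, filed on crux
# `CubeKernelStep` (stmt-KontsevichZagierPeriods-17854, route UnfoldedStokes; d = 1 product sector)
(planner-fwd-rung-KontsevichZagierPeriods-08-0, 2026-08-17; seed g1-KontsevichZagierPeriods-3523)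

This skeleton does NOT conclude the crux `CubeKernelStep` (`∀ d ≥ 1, K(≤d) → K(d+1)`, summit-strength by
`Disproof.lean §0 not_summit_of_not_cubeKernelStep`). It files the NEXT RUNG of the graded family in which the
crux's proved `d = 1` product-sector instance `LegendreAllModuli` (stmt-3523, floor, PROVED by
`Summit.KontsevichZagierPeriods.UnfoldedStokes.LegendreAllModuliLine.LegendreAllModuli_of` @ e062b17d) lives:

* GRADED FAMILY `LegendreSignature s` (`s : ℚ`, one parameter moved: the hypergeometric SIGNATURE;
  `a = 1/2 − s` in the `₂F₁(a,1−a;1;m)` notation of the generalized complete elliptic integrals): for every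
  real algebraic modulus `k ∈ (0,1)`, `m = k²`, with `u_m(x) = x²(1−m x²)/(1−x²)`,
  `κ_m = ((1−x²)(1−m x²))^{-1/2}`, `e_m = (1−m x²)^{1/2}(1−x²)^{-1/2}`, the representation
  `[(0,1)², u_m(x)^s e_m(x)·u_{1−m}(y)^s κ_{1−m}(y) + u_{1−m}(x)^s e_{1−m}(x)·u_m(y)^s κ_m(y) − u_m(x)^s κ_m(x)·u_{1−m}(y)^s κ_{1−m}(y)]`
  (value `Ẽ_s K̃′_s + Ẽ′_s K̃_s − K̃_s K̃′_s`, `K̃_s(m) = ∫₀¹ x^{2s}(1−x²)^{−1/2−s}(1−mx²)^{s−1/2}dx`,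
  `Ẽ_s(m) = ∫₀¹ x^{2s}(1−x²)^{−1/2−s}(1−mx²)^{s+1/2}dx`) is KZ-equivalent to every `[ℝ, 1/(2(1+2s)cos(πs)(1+x²))]`
  (value identity `Ẽ_s K̃′_s + Ẽ′_s K̃_s − K̃_s K̃′_s = π/(2(1+2s)cos πs)`: Elliott 1904 = Andrews–Askey–Roy
  Thm 3.2.8 = Borwein–Borwein *Pi and the AGM* (5.5.6) with `a = 1/2 − s`, `t = x²`; checked numerically to
  `1.2e-14` for `s ∈ {0, 1/6, 1/4, −1/3}`, `m ∈ {0.3, 0.5, 0.81, 0.01}`, folder `num/check_rung2.py`).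
  `LegendreSignature 0` is VERBATIM the floor (F3 witness `legendreSignature_zero` below, `simpa` from the
  floor decl and nothing else; published as `Lines/legendre_signatures_special.lean`).
* THE RUNG `LegendreAllSignatures := ∀ s : ℚ, −1/2 < s < 1/2 → LegendreSignature s` (the whole convergent
  range at once). It is, up to the 2-dimensional rule-(2) move `(x,y) ↦ (x²,y²)`, scaling by the algebraic
  constant `2(1+2s)cos πs = 4(1−a)sin πa` and the disc/arctan link, the open crux
  `CyclesAsDomains.GeneralizedLegendre` (stmt-KontsevichZagierPeriods-10421, rank 6, XL, no line registered):
  `GeneralizedLegendre_of_rung` below records `LegendreAllSignatures → TransferToCycles → GeneralizedLegendre`.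

## The lever (why ONE extra idea carries the floor's chain to every signature)

After the floor's swap-symmetrisation (M1) the rung's integrand is `G_{s,m} = (u_m(x)·u_{1−m}(y))^s · F_m(x,y)`
with `F_m` the floor's Legendre 2-form, and UNDER JACOBI'S SPHERO-CONAL CHART `Φ_m(x,y) = (X,Z) =
(x√(1−(1−m)y²), y√(1−m x²))` of the floor's M2 the weight is MODULUS-FREE:
`u_m(x)·u_{1−m}(y) = X²Z²/(1 − X² − Z²)` (because `1 − X² − Z² = (1−x²)(1−y²)`). Hence the SAME single
rule-(2) move as the floor takes `[(0,1)², G_{s,m}]` to the `m`-independent octant representation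
`[Q, (X²Z²/(1−X²−Z²))^s (1−X²−Z²)^{-1/2}]`, `Q = {X, Z > 0, X² + Z² < 1}` (stub `WeightedOctantTransfer`).
From there: Dirichlet's substitution `(X,Z) = (√(ρt), √(ρ(1−t)))` (Jacobian `1/(4√(t(1−t)))`) separates to
`(1/4)[(0,1)², ρ^{2s}(1−ρ)^{−s−1/2}·t^{s−1/2}(1−t)^{s−1/2}]`; the simplex bijection
`(ρ,t) ↦ (u',v') = (1 − ρt, ρ(1−t)/(1−ρt))` (Dirichlet's `B(a,b)B(a+b,c) = B(b,c)B(b+c,a)` as ONE move) gives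
`(1/4)[(0,1)², (1−u')^{s−1/2}·v'^{s−1/2}(1−v')^{−s−1/2}]`; ONE Newton–Leibniz move along `u'` with the
ALGEBRAIC primitive `−(1−u')^{s+1/2}/(s+1/2)` (continuous on `[0,1]`); `v' = x²/(1+x²)` and unfolding to `ℝ`
give `[ℝ, (x²)^s/(2(1+2s)(1+x²))]` (stub `DirichletBeta`). The last step `EulerReflection` is Euler's
`B(1/2+s,1/2−s)·cos(πs) = π` INSIDE the rules at rational `s`; at `a = s + 1/2` this is EXACTLY the existing open
item `CompiledSubstitutions.EulerReflectionRational` (stmt-KontsevichZagierPeriods-3383, rank 5, summit-implied by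
the landed `BetaCancellationNegative.stubEulerReflection_of_summit`, instance `a = 1/2` landed as
`stubEulerReflection_half`), so the registered stub is only the TRANSFER `EulerReflectionRational → EulerReflection`
(even unfolding `ℝ → (0,∞)`, `v = x²/(1+x²)`, the algebraic constant `1/(2(1+2s)cos πs)` through
`KZ.Equivalent.constMul`, and `[disc, 1] ~ [ℝ, 1/(1+x²)]` = the landed `piNormalisation_proof`) and the rung is
reduced to stmt-3383 by name. For the record, 3383's own chain is log-free here: `x = u^q` rationalises `β_s` to
`q·u^{m−1}/(1+uⁿ)` (`n = 2q`, `m = 2p+q`, both exponents natural), folding `(1,∞)` onto `(0,1)` by `u ↦ 1/u`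
gives `q(u^{m−1}+u^{n−m−1})/((1+2s)(1+uⁿ))` whose residues `−(ζ^m − ζ^{−m})/n = −2i·sin(mθ_j)/n` are PURELY
IMAGINARY, so its partial-fraction expansion (integrand additivity) has NO logarithmic terms:
`(4/n)Σ_j sin(mθ_j) sinθ_j/(u² − 2u cosθ_j + 1)`, `θ_j = (2j−1)π/n`; each term is an affine image of an ARC of
`dv/(1+v²)` with endpoints at angles in `(π/(2n))ℤ`; Möbius ROTATIONS `v ↦ (v − τ)/(1 + vτ)`, `τ = tan(iπ/(2n))`
(rule 2, `dv/(1+v²)` is rotation-invariant) carry every unit arc to one common arc `U`, and integrand additivity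
collects both sides to `[U, A/(1+v²)]`, `[U, B/(1+v²)]` with algebraic `A, B`; `A = B` by VALUE comparison
(soundness `KZ.relations_le_ker_eval` + the tree lemma `integral_rpow_div_add`:
`∫₀^∞ t^{σ−1}/(t+1) dt = π/sin(πσ)` at `σ = s + 1/2`) — consistent with the BetaCancellation disprover's
residue check (Cruxes/BetaCancellation/DrefuteG3StubEulerReflection.md). Every primitive in the chain is algebraic
(`AlgebraicPrimitivesObstruction` is not engaged); the chain uses rule (2) in dimension 2 along maps that MOVE
BOTH coordinates (honours `Disproof.lean ★ cubeKernelStep_false_without_changeOfVariables` and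
`★★ cubeKernelStep_false_fibred`: no fibred / parameter-preserving proof of a `1 → 2` instance exists).

## Where the floor's proof stops (Attack axis)

`Theorems/UnfoldedStokesLegendreAllModuli.lean`: M1 (`stub_symmetrise`) and M2 (`stub_octantTransfer`
ll. 216–298, chart facts `OctantMove.*` ll. 63–207) survive verbatim thanks to the weight identity; M3
`stub_discToStrip` (`Θ(s,y) = (s√(1−y²)/√(1+s²), y)` rationalises `(1−X²−Z²)^{-1/2}` ONLY — with the factor
`(XZ)^{2s}(1−X²−Z²)^{−s}` the strip integrand is no longer `1/(1+s²)`) and M4/M5 (`stub_stripNewtonLeibniz`,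
`stub_halfLineTail`: the only transcendental available is `arctan`) FAIL at `s ≠ 0`; they are replaced by
`DirichletBeta` (Beta/Dirichlet substitutions, algebraic NL — the simplex charts are the landed
`KZ.dirichletPolar_equivalent` / `KZ.dirichletLinear_equivalent`, the `u'`-integration is the landed
`KZ.betaFirst_equivalent_unit_constMul` pattern) and by the transfer to `EulerReflectionRational`.
-/

noncomputable section

set_option linter.dupNamespace false

open Set
open Literature.NumberTheory.Transcendental
open Literature.NumberTheory.Transcendental.KZ

namespace Summit.KontsevichZagierPeriods.KontsevichZagierPeriods.Cruxes.CubeKernelStep.LegendreSignatures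

open Summit.KontsevichZagierPeriods.KontsevichZagierPeriods.Theses.UnfoldedStokes (CubeKernelStep LegendreAllModuli)
open Summit.KontsevichZagierPeriods.KontsevichZagierPeriods.Theses.CyclesAsDomains (GeneralizedLegendre)
open Summit.KontsevichZagierPeriods.KontsevichZagierPeriods.Theses.CompiledSubstitutions (EulerReflectionRational)

/-! ## The graded family and the rung -/

/-- The generalized Legendre relation of signature `s` (`a = 1/2 − s`), for every real algebraic modulus
`k ∈ (0,1)`, inside the KZ calculus (see the module docstring). `s = 0` is verbatim `LegendreAllModuli`. -/
def LegendreSignature (s : ℚ) : Prop :=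
  ∀ k : ℝ, IsAlgebraic ℚ k → 0 < k → k < 1 →
    ∀ (r : KZ.IntegralRep 2) (r' : KZ.IntegralRep 1),
      r.domain = {x | ∀ i, x i ∈ Set.Ioo (0 : ℝ) 1} →
      Set.EqOn r.integrand (fun x =>
          (x 0 ^ 2 * (1 - k ^ 2 * x 0 ^ 2) / (1 - x 0 ^ 2)) ^ (s : ℝ) *
              (x 1 ^ 2 * (1 - (1 - k ^ 2) * x 1 ^ 2) / (1 - x 1 ^ 2)) ^ (s : ℝ) *
            (Real.sqrt (1 - k ^ 2 * x 0 ^ 2) / Real.sqrt (1 - x 0 ^ 2) /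
              Real.sqrt ((1 - x 1 ^ 2) * (1 - (1 - k ^ 2) * x 1 ^ 2))) +
          (x 0 ^ 2 * (1 - (1 - k ^ 2) * x 0 ^ 2) / (1 - x 0 ^ 2)) ^ (s : ℝ) *
              (x 1 ^ 2 * (1 - k ^ 2 * x 1 ^ 2) / (1 - x 1 ^ 2)) ^ (s : ℝ) *
            (Real.sqrt (1 - (1 - k ^ 2) * x 0 ^ 2) / Real.sqrt (1 - x 0 ^ 2) /
              Real.sqrt ((1 - x 1 ^ 2) * (1 - k ^ 2 * x 1 ^ 2))) -
          (x 0 ^ 2 * (1 - k ^ 2 * x 0 ^ 2) / (1 - x 0 ^ 2)) ^ (s : ℝ) *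
              (x 1 ^ 2 * (1 - (1 - k ^ 2) * x 1 ^ 2) / (1 - x 1 ^ 2)) ^ (s : ℝ) *
            (1 / Real.sqrt ((1 - x 0 ^ 2) * (1 - k ^ 2 * x 0 ^ 2)) /
              Real.sqrt ((1 - x 1 ^ 2) * (1 - (1 - k ^ 2) * x 1 ^ 2)))) r.domain →
      r'.domain = Set.univ →
      Set.EqOn r'.integrand
        (fun x => 1 / (2 * (1 + 2 * (s : ℝ)) * Real.cos (Real.pi * s) * (1 + x 0 ^ 2))) r'.domain →
      KZ.Equivalent r r'

/-- THE RUNG (`rung_decl`): every rational signature of the convergent range at once. -/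
def LegendreAllSignatures : Prop :=
  ∀ s : ℚ, (-1/2 : ℚ) < s → s < 1/2 → LegendreSignature s

/-- The rung's integrand `G_{s,k}` as a named function (the body of `LegendreSignature`, verbatim). -/
def G (s : ℚ) (k : ℝ) (x : Fin 2 → ℝ) : ℝ :=
  (x 0 ^ 2 * (1 - k ^ 2 * x 0 ^ 2) / (1 - x 0 ^ 2)) ^ (s : ℝ) *
      (x 1 ^ 2 * (1 - (1 - k ^ 2) * x 1 ^ 2) / (1 - x 1 ^ 2)) ^ (s : ℝ) *
    (Real.sqrt (1 - k ^ 2 * x 0 ^ 2) / Real.sqrt (1 - x 0 ^ 2) /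
      Real.sqrt ((1 - x 1 ^ 2) * (1 - (1 - k ^ 2) * x 1 ^ 2))) +
  (x 0 ^ 2 * (1 - (1 - k ^ 2) * x 0 ^ 2) / (1 - x 0 ^ 2)) ^ (s : ℝ) *
      (x 1 ^ 2 * (1 - k ^ 2 * x 1 ^ 2) / (1 - x 1 ^ 2)) ^ (s : ℝ) *
    (Real.sqrt (1 - (1 - k ^ 2) * x 0 ^ 2) / Real.sqrt (1 - x 0 ^ 2) /
      Real.sqrt ((1 - x 1 ^ 2) * (1 - k ^ 2 * x 1 ^ 2))) -
  (x 0 ^ 2 * (1 - k ^ 2 * x 0 ^ 2) / (1 - x 0 ^ 2)) ^ (s : ℝ) *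
      (x 1 ^ 2 * (1 - (1 - k ^ 2) * x 1 ^ 2) / (1 - x 1 ^ 2)) ^ (s : ℝ) *
    (1 / Real.sqrt ((1 - x 0 ^ 2) * (1 - k ^ 2 * x 0 ^ 2)) /
      Real.sqrt ((1 - x 1 ^ 2) * (1 - (1 - k ^ 2) * x 1 ^ 2)))

/-- The open positive octant chart image `Q = {X > 0, Z > 0, X² + Z² < 1}` (the floor's M2 target). -/
def quarterDisc : Set (Fin 2 → ℝ) := {w | 0 < w 0 ∧ 0 < w 1 ∧ w 0 ^ 2 + w 1 ^ 2 < 1}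

/-- The weighted octant density `ρ_s(X,Z) = (X²Z²/(1−X²−Z²))^s · (1−X²−Z²)^{-1/2}`. -/
def octantDensity (s : ℚ) (w : Fin 2 → ℝ) : ℝ :=
  (w 0 ^ 2 * w 1 ^ 2 / (1 - w 0 ^ 2 - w 1 ^ 2)) ^ (s : ℝ) * (1 / Real.sqrt (1 - w 0 ^ 2 - w 1 ^ 2))

/-- The Beta-line density `β_s(x) = (x²)^s/(2(1+2s)(1+x²))` on `ℝ` (value `B(1/2+s,1/2−s)/(2(1+2s))`). -/
def betaLineDensity (s : ℚ) (x : Fin 1 → ℝ) : ℝ :=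
  (x 0 ^ 2) ^ (s : ℝ) / (2 * (1 + 2 * (s : ℝ)) * (1 + x 0 ^ 2))

/-- The target density `1/(2(1+2s)cos(πs)(1+x²))` on `ℝ` (value `π/(2(1+2s)cos πs)`). -/
def targetDensity (s : ℚ) (x : Fin 1 → ℝ) : ℝ :=
  1 / (2 * (1 + 2 * (s : ℝ)) * Real.cos (Real.pi * s) * (1 + x 0 ^ 2))

/-! ## Stub statements -/

/-- STUB 1 statement (M; M1 + M2 of the floor with the modulus-free weight): symmetrisation and ONE
rule-(2) move along Jacobi's sphero-conal chart take `[(0,1)², G_{s,k}]` to `[Q, ρ_s]`. -/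
def WeightedOctantTransfer : Prop :=
  ∀ s : ℚ, (-1/2 : ℚ) < s → s < 1/2 → ∀ k : ℝ, IsAlgebraic ℚ k → 0 < k → k < 1 →
    ∀ r : KZ.IntegralRep 2, r.domain = {x | ∀ i, x i ∈ Set.Ioo (0 : ℝ) 1} →
      Set.EqOn r.integrand (G s k) r.domain →
      ∃ p : KZ.IntegralRep 2, p.domain = quarterDisc ∧ Set.EqOn p.integrand (octantDensity s) p.domain ∧
        KZ.Equivalent r p

/-- STUB 2 statement (M–L; replaces the floor's M3/M4): Dirichlet substitution, the simplex bijection,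
ONE Newton–Leibniz move with the algebraic primitive `−(1−u)^{s+1/2}/(s+1/2)`, `v = x²/(1+x²)` and the
unfolding to `ℝ` take `[Q, ρ_s]` to `[ℝ, β_s]`. -/
def DirichletBeta : Prop :=
  ∀ s : ℚ, (-1/2 : ℚ) < s → s < 1/2 →
    ∀ p : KZ.IntegralRep 2, p.domain = quarterDisc → Set.EqOn p.integrand (octantDensity s) p.domain →
      ∃ b : KZ.IntegralRep 1, b.domain = Set.univ ∧ Set.EqOn b.integrand (betaLineDensity s) b.domain ∧
        KZ.Equivalent p b

/-- STEP 3 statement (replaces the floor's M5): Euler's reflection `B(1/2+s,1/2−s)·cos(πs) = π` inside the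
rules at rational `s`: `[ℝ, β_s] ~ [ℝ, 1/(2(1+2s)cos(πs)(1+x²))]`. Registered only as the TRANSFER
`stub_eulerTransfer : EulerReflectionRational → EulerReflection` from item stmt-KontsevichZagierPeriods-3383
(instance `a = s + 1/2`). -/
def EulerReflection : Prop :=
  ∀ s : ℚ, (-1/2 : ℚ) < s → s < 1/2 →
    ∀ b r' : KZ.IntegralRep 1, b.domain = Set.univ → Set.EqOn b.integrand (betaLineDensity s) b.domain →
      r'.domain = Set.univ → Set.EqOn r'.integrand (targetDensity s) r'.domain →
      KZ.Equivalent b r'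

/-- TRANSFER statement (M, bookkeeping inside the rules; not used by `LegendreAllSignatures_of`): the rung in
`x`-variables gives the `t = x²` / disc form `CyclesAsDomains.GeneralizedLegendre` (stmt-10421). For every
rational `a ∈ (0,1)` and real algebraic `m ∈ (0,1)` and every pair `(r, r')` as in `GeneralizedLegendre`
there are an algebraic `k` (`= √m`) and representations `rx = [(0,1)², G_{1/2−a,k}]`, `rx' = [ℝ, target]`
(pull `r` back along `(x,y) ↦ (x²,y²)`, rule 2 — integrability transported; scale by the algebraic constant
`4(1−a)sin(πa)` through the product ideal `KZProductIdeal.of_mul_mem_relations`; `[ℝ, 1/(1+x²)] ~ [disc, 1]`)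
such that `rx ~ rx'` implies `r ~ r'`. -/
def TransferToCycles : Prop :=
  ∀ (a : ℚ) (m : ℝ), 0 < a → a < 1 → IsAlgebraic ℚ m → 0 < m → m < 1 →
    ∀ (r r' : KZ.IntegralRep 2),
      r.domain = {x | ∀ i, x i ∈ Set.Ioo (0:ℝ) 1} →
      Set.EqOn r.integrand (fun x => (1 - (a:ℝ)) * Real.sin (Real.pi * a) *
        ((x 0) ^ (-(a:ℝ)) * (1 - x 0) ^ ((a:ℝ) - 1) * (1 - m * x 0) ^ (1 - (a:ℝ)) *
            ((x 1) ^ (-(a:ℝ)) * (1 - x 1) ^ ((a:ℝ) - 1) * (1 - (1 - m) * x 1) ^ (-(a:ℝ))) +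
          (x 0) ^ (-(a:ℝ)) * (1 - x 0) ^ ((a:ℝ) - 1) * (1 - (1 - m) * x 0) ^ (1 - (a:ℝ)) *
            ((x 1) ^ (-(a:ℝ)) * (1 - x 1) ^ ((a:ℝ) - 1) * (1 - m * x 1) ^ (-(a:ℝ))) -
          (x 0) ^ (-(a:ℝ)) * (1 - x 0) ^ ((a:ℝ) - 1) * (1 - m * x 0) ^ (-(a:ℝ)) *
            ((x 1) ^ (-(a:ℝ)) * (1 - x 1) ^ ((a:ℝ) - 1) * (1 - (1 - m) * x 1) ^ (-(a:ℝ))))) r.domain →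
      r'.domain = {x | x 0 ^ 2 + x 1 ^ 2 ≤ 1} → Set.EqOn r'.integrand (fun _ => (1:ℝ)) r'.domain →
      ∃ (k : ℝ) (rx : KZ.IntegralRep 2) (rx' : KZ.IntegralRep 1),
        IsAlgebraic ℚ k ∧ 0 < k ∧ k < 1 ∧
        rx.domain = {x | ∀ i, x i ∈ Set.Ioo (0 : ℝ) 1} ∧ Set.EqOn rx.integrand (G (1/2 - a) k) rx.domain ∧
        rx'.domain = Set.univ ∧ Set.EqOn rx'.integrand (targetDensity (1/2 - a)) rx'.domain ∧
        (KZ.Equivalent rx rx' → KZ.Equivalent r r')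

/-! ## Registered stubs -/

/-- STUB 1 (M): weighted octant transfer. Reuses the LANDED chart facts of the floor
(`LegendreAllModuliLine.stub_spheroConalChart`, `OctantMove.hasFDerivAt_spheroConal`,
`isSemialgebraicMapOn_spheroConal`, `isSemialgebraic_quarterDisc`) plus the pointwise identity
`u_m(x)u_{1−m}(y) = X²Z²/(1−X²−Z²)` and semialgebraicity of `t ↦ t^s` for rational `s`. -/
theorem stub_weightedOctantTransfer : WeightedOctantTransfer := by
  sorry

/-- STUB 2 (M–L): Dirichlet–Beta separation with an algebraic Newton–Leibniz primitive. -/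
theorem stub_dirichletBeta : DirichletBeta := by
  sorry

/-- STUB 3 (M, transfer from the existing item stmt-KontsevichZagierPeriods-3383 at `a = s + 1/2`): even unfolding
`[ℝ, β_s] ~ [(0,∞), 2β_s]` (domain additivity + the reflection `x ↦ −x`, rule 2), `v = x²/(1+x²)` (rule 2, onto
`(0,1)`; `2β_s` pulls back to `v^{s−1/2}(1−v)^{−s−1/2}/(2(1+2s))`), the algebraic constant
`c_s = 1/(2(1+2s)·sin(π(s+1/2)))` (`isAlgebraic_sin_pi_mul_rat`, `KZ.Equivalent.constMul`) against 3383's pinned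
representation `[(0,1), sin(πa)v^{a−1}(1−v)^{−a}] ~ [disc, 1]`, and `c_s·[disc, 1] ~ [ℝ, c_s/(1+x²)]`
(`CompiledSubstitutions.PiNormalisation`, landed `piNormalisation_proof`, scaled by `constMul`);
`sin(π(s+1/2)) = cos(πs)`. -/
theorem stub_eulerTransfer : EulerReflectionRational → EulerReflection := by
  sorry

/-- STUB 4 (M, transfer to stmt-10421; outside the composition of the rung). -/
theorem stub_transferToCycles : TransferToCycles := by
  sorry

/-! ## Compositions (real proofs) -/

/-- **The rung from the three steps**: `r ~ p ~ b ~ r'`. -/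
theorem LegendreAllSignatures_of_steps :
    WeightedOctantTransfer → DirichletBeta → EulerReflection → LegendreAllSignatures := by
  intro h1 h2 h3 s hs1 hs2 k hk hk0 hk1 r r' hrd hri hr'd hr'i
  obtain ⟨p, hpd, hpi, hp⟩ := h1 s hs1 hs2 k hk hk0 hk1 r hrd hri
  obtain ⟨b, hbd, hbi, hb⟩ := h2 s hs1 hs2 p hpd hpi
  exact hp.trans (hb.trans (h3 s hs1 hs2 b r' hbd hbi hr'd hr'i))

/-- **The rung from the three registered stubs and the existing item `EulerReflectionRational`**
(stmt-KontsevichZagierPeriods-3383, by name). -/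
theorem LegendreAllSignatures_of :
    WeightedOctantTransfer → DirichletBeta → (EulerReflectionRational → EulerReflection) →
      EulerReflectionRational → LegendreAllSignatures :=
  fun h1 h2 h3 hE => LegendreAllSignatures_of_steps h1 h2 (h3 hE)

/-- The rung, once the three registered stubs and item stmt-3383 are proved. -/
theorem LegendreAllSignatures_proof : EulerReflectionRational → LegendreAllSignatures :=
  LegendreAllSignatures_of stub_weightedOctantTransfer stub_dirichletBeta stub_eulerTransfer

/-- **The rung closes `CyclesAsDomains.GeneralizedLegendre`** (stmt-KontsevichZagierPeriods-10421) through the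
transfer stub. -/
theorem GeneralizedLegendre_of_rung : LegendreAllSignatures → TransferToCycles → GeneralizedLegendre := by
  intro h ht a m ha0 ha1 hm hm0 hm1 r r' hrd hri hr'd hr'i
  obtain ⟨k, rx, rx', hk, hk0, hk1, hxd, hxi, hxd', hxi', himp⟩ :=
    ht a m ha0 ha1 hm hm0 hm1 r r' hrd hri hr'd hr'i
  refine himp (h (1/2 - a) (by linarith) (by linarith) k hk hk0 hk1 rx rx' hxd hxi hxd' hxi')

/-! ## F3 / F4 bookkeeping -/

/-- F3 WITNESS: the floor parameter `s = 0` is the PROVED floor `LegendreAllModuli` and nothing else. -/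
theorem legendreSignature_zero : LegendreSignature 0 := by
  simpa [LegendreSignature, LegendreAllModuli]
    using Summit.KontsevichZagierPeriods.UnfoldedStokes.LegendreAllModuliLine.LegendreAllModuli_of

/-- The identification at `s = 0` is exact (no weakening): `LegendreSignature 0 ↔ LegendreAllModuli`. -/
theorem legendreSignature_zero_iff : LegendreSignature 0 ↔ LegendreAllModuli := by
  constructor
  · intro h; simpa [LegendreSignature, LegendreAllModuli] using h
  · intro h; simpa [LegendreSignature, LegendreAllModuli] using h

end Summit.KontsevichZagierPeriods.KontsevichZagierPeriods.Cruxes.CubeKernelStep.LegendreSignatures
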